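import Mathlib
import Summits.Ventures.FusionMHD.Models.SAlphaStableS2A1Core0
import HarnessLib

/-!
# STABLE-POINT core at `(2, 1)`, piece 4 (`[4, 6]`): kernel-decided Taylor-model leaves ⇒ `F_4 > 0` and `amplitudeResidual 2 (1) F_4 F_4″ ≤ 0` on the piece ⇒ `EnergyDominatesOn` for its amplitude phase

LADDER-GRIDFUSION rung F3 («F3.BALLOON-sα-STABLE-POINT-S2-A1»: the first stable-side point at shear s = 2); gridfusion-model-7 g8, 2026-08-28.  Two `decide +kernel` calls (`OpModel.trig.pLeavesCheck`, scale
`2^60`, Taylor degree 10, 16 leaves of half-width 1/16) and the lane's soundness theorem `OpSem.trig.pos_of_pLeavesCheck`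
(Literature/Analysis/ValidatedNumerics/TaylorModelZeroCert); lit-4's `energyDominatesOn_of_amplitude` (BallooningSAlphaStableSide) turns the two
sign facts into energy domination by `amplitudePhase 2 (1) F_4 F_4′` on the piece.  MODELLED: `s–α` model; nothing about a device.
No `native_decide`.  Citations: Freidberg 2014 §12.6.2 (12.97) [Freidberg2014]; Makino–Berz 2003 Alg. 2 [MakinoBerz2003]; Hartman 2002 XI.6.2
[Hartman2002].  Everything here is [instance data].
-/

open Literature.Analysis.ValidatedNumerics Literature.Analysis.ValidatedNumerics.PolyMP
open Literature.Analysis.ValidatedNumerics.NumericsMP Literature.Analysis.ValidatedNumerics.ExpPoly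
open Literature.MathematicalPhysics.MHD.Ballooning
open Real Set

namespace Summit.Ventures.FusionMHD.Models

namespace SAlphaStableS2A1

/-- KERNEL CHECK (residual leaves of piece 4). [instance data] -/
theorem s2a1_res4_ok : OpModel.trig.pLeavesCheck s2a1Prm (2 ^ 60) (s2a1Prog W4 (Poly.deriv (Poly.deriv W4))) [] s2a1Leaves4 = true := by
  decide +kernel

/-- KERNEL CHECK (positivity leaves of piece 4). [instance data] -/
theorem s2a1_pos4_ok : OpModel.trig.pLeavesCheck s2a1Prm (2 ^ 60) (s2a1PosProg W4) [] s2a1Leaves4 = true := by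
  decide +kernel

/-- The leaves tile `[4, 6]`. [instance data] -/
theorem s2a1_tiles4 : tiles (4 : ℚ) (s2a1Leaves4.map fun l => (l.e, l.k)) (6 : ℚ) = true := by
  decide +kernel

/-- **PIECE 4**: the phase of `F_4` dominates the `s–α` energy on `[4, 6]` at `(s, α) = (2, 1)`. [instance data] -/
theorem s2a1_dominates4 :
    SAlpha.EnergyDominatesOn 2 (1) (SAlpha.amplitudePhase 2 (1) (Poly.eval W4) (Poly.eval (Poly.deriv W4)))
      (Icc (4 : ℝ) (6 : ℝ)) := by
  have h := s2a1_dominates (lf := W4) (x := 4) (y := 6) (by norm_num) s2a1_tiles4 s2a1_res4_ok s2a1_pos4_ok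
  norm_num at h
  exact h

end SAlphaStableS2A1

end Summit.Ventures.FusionMHD.Models
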